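import Literature.MathematicalPhysics.QuantumFieldTheory.WilsonTorusTransferMatrix
import Literature.Analysis.Matrix.SchoenbergKernelsProofs
import Literature.Analysis.Matrix.PosDefKernelDoubleIntegral
import Literature.Analysis.Matrix.ExpAbsKernel
import HarnessLib

/-!
# Crux `IRcof` (stmt-QuantumFields-26930) · line `equipartition_seam` (row 47) · located stub L `SpectralDict.SliceRealisationV` — helper:
# the gauge-averaged SLICE KERNEL of a GENERAL weight, F1 ∕ 7 — §2 ALGEBRA of the slice kernel of a general weight (`tempKernel`, `freeKernel`, `gauge`, `ctwist`, gauge covariance, central-twist invariance, Schur product) and §3 MEASURE THEORY (Haar products, measure preservation, the gauge-averaged kernel `avgKernel`, its symmetry, measurability and POSITIVE TYPE — Lüscher's gauge averaging; §1 sampling cited from Literature L34 BY NAME)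

SOURCE OF RECORD: `Cruxes/IRcof/Lines/equipartition_seam_SliceKernel.lean` rev 9 (crux write 148dcb46cebb, 2172 l.; author ideator ym-ir-idea-22 g7; critic ym-ir-crit-3 g5 TYPEREADs CLEAN of revs 1–6 (bus l.1748 ∕ 1758 ∕ 1768 ∕ 1775 ∕ 1780), placement ruling H1 ∕ H2 (l.1748: §1 → Literature = lit-4 L34 p694639; §2 onward → ≤ 400-line Theorems files) — split VERBATIM along its §§ by LEAD prover ym-ir-line-ab-p1 g8 on the ideator's LAND-ASK H2 (bus l.1786 ∕ l.1789: files F1–F7, each importing the previous).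

HONEST FRAMING.  Elementary measure theory ∕ Fubini on compact groups (Lüscher 1977 ∕ Osterwalder–Seiler 1978 transfer-matrix positivity, weight-generic); proves NO located stub of row 47 by itself (S1, S3ʷ, T, L, N, S5ᵛ open); row 47 class PWP, mechanism 0, width 0; `IRcof` ∕ `IR` 0∕1; the Yang–Mills mass gap (Clay) is NOT proved by anything in this tree; R4 closes only the conditional finite-𝕋⁴ rung `BalabanLadder.UV`.
-/

noncomputable section

open MeasureTheory ProbabilityTheory Finset Filter Function
open scoped BigOperators

namespace Summit.QuantumFields.YangMills.Cruxes.IRcof.EquipartitionSeam.SliceKernel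

open Literature.Analysis.Matrix (IsPosDefKernel isPosDefKernel_const IsPosDefKernel.integral_prod_nonneg_of_measurable)
open Literature.MathematicalPhysics.QuantumFieldTheory (haarProbability integral_integral_fibreAverage_nonneg
  integrable_of_abs_le_one abs_mul_mul_le_one abs_integral_le_one)

/-! ### §1 Sampling — NOW IN LITERATURE (rev 8).  Revs 1–7 carried here `integral_gramSum_pi`,
`integral_prod_nonneg_of_isPosDefKernel`, `integral_integral_nonneg_of_isPosDefKernel` (a bounded measurable `IsPosDefKernel`
is of positive type against bounded MEASURABLE test functions); lit-4 lifted them verbatim into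
`Literature/Analysis/Matrix/PosDefKernelDoubleIntegral.lean` (L34, p694639; crit-3 placement H1, l.1748) as
`Literature.Analysis.Matrix.integral_gramSum_pi` ∕ `IsPosDefKernel.integral_prod_nonneg_of_measurable` ∕
`IsPosDefKernel.integral_integral_nonneg_of_measurable` (same argument order); §3 below cites them BY NAME. -/

/-! ### §2 Algebra of the slice kernel of a general weight: temporal-plaquette product, gauge action, central twists -/

section Algebra

variable {P Λ H : Type*} [Group H] (src tgt : Λ → P)

/-- Gauge transformation of a slice configuration by a site field `a`: `V_l ↦ a(src l) V_l a(tgt l)⁻¹`. -/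
def gauge (a : P → H) (V : Λ → H) : Λ → H := fun l => a (src l) * V l * (a (tgt l))⁻¹

/-- Left multiplication of the slice links by a link field `c` (a CENTRAL `c` supported on a 't Hooft stack is the
seam operator `U_e` of the line). -/
def ctwist (c : Λ → H) (V : Λ → H) : Λ → H := fun l => c l * V l

omit [Group H] in
/-- Auxiliary `ctwist_def` of the slice-kernel port (its statement is its type; rôle explained in the module ∕ section docstrings). -/
theorem ctwist_def [Mul H] (c V : Λ → H) : (fun l => c l * V l) = c * V := rfl

/-- Auxiliary `ctwist_one` of the slice-kernel port (its statement is its type; rôle explained in the module ∕ section docstrings). -/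
theorem ctwist_one : ctwist (1 : Λ → H) = id := by
  funext V; ext l; simp [ctwist]

/-- Auxiliary `ctwist_mul` of the slice-kernel port (its statement is its type; rôle explained in the module ∕ section docstrings). -/
theorem ctwist_mul (c c' : Λ → H) : ctwist (c * c') = ctwist c ∘ ctwist c' := by
  funext V l; simp [ctwist, mul_assoc]

variable [Fintype Λ] (w : H → ℝ)

/-- Product of the temporal-plaquette weights between consecutive slices `V, V'` with temporal links `g`:
`∏_l w(V_l⁻¹ g_{src l} V'_l g_{tgt l}⁻¹)`. -/
def tempKernel (V : Λ → H) (g : P → H) (V' : Λ → H) : ℝ :=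
  ∏ l, w ((V l)⁻¹ * g (src l) * V' l * (g (tgt l))⁻¹)

/-- The un-averaged (temporal gauge) kernel `∏_l w(V_l⁻¹ V'_l)`. -/
def freeKernel (V V' : Λ → H) : ℝ := ∏ l, w ((V l)⁻¹ * V' l)

/-- Auxiliary `tempKernel_one` of the slice-kernel port (its statement is its type; rôle explained in the module ∕ section docstrings). -/
theorem tempKernel_one (V V' : Λ → H) : tempKernel src tgt w V 1 V' = freeKernel w V V' := by
  simp [tempKernel, freeKernel]

/-- Gauge covariance: `k(V^a, a/b, V'^b) = k₀(V, V')` for a class function `w`. -/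
theorem tempKernel_gauge_div (hcl : ∀ g h, w (g * h * g⁻¹) = w h) (a b : P → H) (V V' : Λ → H) :
    tempKernel src tgt w (gauge src tgt a V) (a / b) (gauge src tgt b V') = freeKernel w V V' := by
  unfold tempKernel freeKernel gauge
  refine Finset.prod_congr rfl fun l _ => ?_
  rw [show (a (src l) * V l * (a (tgt l))⁻¹)⁻¹ * (a / b) (src l) * (b (src l) * V' l * (b (tgt l))⁻¹) *
      ((a / b) (tgt l))⁻¹ = a (tgt l) * ((V l)⁻¹ * V' l) * (a (tgt l))⁻¹ by
    simp only [Pi.div_apply, div_eq_mul_inv]; group, hcl]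

/-- Central twists leave the temporal kernel invariant: `k(cV, g, cV') = k(V, g, V')`. -/
theorem tempKernel_ctwist {c : Λ → H} (hc : ∀ l, c l ∈ Subgroup.center H) (V : Λ → H) (g : P → H)
    (V' : Λ → H) : tempKernel src tgt w (ctwist c V) g (ctwist c V') = tempKernel src tgt w V g V' := by
  unfold tempKernel ctwist
  refine Finset.prod_congr rfl fun l _ => ?_
  have hz : g (src l) * c l = c l * g (src l) := Subgroup.mem_center_iff.mp (hc l) (g (src l))
  rw [show (c l * V l)⁻¹ * g (src l) * (c l * V' l) = (V l)⁻¹ * ((c l)⁻¹ * (g (src l) * c l)) * V' l by group,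
    hz, inv_mul_cancel_left]

/-- Auxiliary `freeKernel_ctwist` of the slice-kernel port (its statement is its type; rôle explained in the module ∕ section docstrings). -/
theorem freeKernel_ctwist (c V V' : Λ → H) : freeKernel w (ctwist c V) (ctwist c V') = freeKernel w V V' := by
  unfold freeKernel ctwist
  refine Finset.prod_congr rfl fun l _ => ?_
  rw [show (c l * V l)⁻¹ * (c l * V' l) = (V l)⁻¹ * V' l by group]

/-- Symmetry up to inversion of the temporal links: `k(V', g⁻¹, V) = k(V, g, V')` for an inversion-invariant
class function. -/
theorem tempKernel_swap_inv (hinv : ∀ h, w h⁻¹ = w h) (hcl : ∀ g h, w (g * h * g⁻¹) = w h) (V : Λ → H)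
    (g : P → H) (V' : Λ → H) : tempKernel src tgt w V' g⁻¹ V = tempKernel src tgt w V g V' := by
  unfold tempKernel
  refine Finset.prod_congr rfl fun l _ => ?_
  simp only [Pi.inv_apply, inv_inv]
  rw [← hinv, show ((V' l)⁻¹ * (g (src l))⁻¹ * V l * g (tgt l))⁻¹ =
      (g (tgt l))⁻¹ * ((V l)⁻¹ * g (src l) * V' l * (g (tgt l))⁻¹) * ((g (tgt l))⁻¹)⁻¹ by group, hcl]

/-- Auxiliary `freeKernel_symm` of the slice-kernel port (its statement is its type; rôle explained in the module ∕ section docstrings). -/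
theorem freeKernel_symm (hinv : ∀ h, w h⁻¹ = w h) (V V' : Λ → H) : freeKernel w V' V = freeKernel w V V' := by
  unfold freeKernel
  refine Finset.prod_congr rfl fun l _ => ?_
  rw [← hinv, mul_inv_rev, inv_inv]

/-- Auxiliary `abs_tempKernel_le_one` of the slice-kernel port (its statement is its type; rôle explained in the module ∕ section docstrings). -/
theorem abs_tempKernel_le_one (hw0 : ∀ h, 0 ≤ w h) (hw1 : ∀ h, w h ≤ 1) (V : Λ → H) (g : P → H)
    (V' : Λ → H) : |tempKernel src tgt w V g V'| ≤ 1 := by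
  unfold tempKernel
  rw [Finset.abs_prod]
  exact Finset.prod_le_one (fun l _ => abs_nonneg _) fun l _ => (abs_of_nonneg (hw0 _)).trans_le (hw1 _)

/-- Auxiliary `tempKernel_nonneg` of the slice-kernel port (its statement is its type; rôle explained in the module ∕ section docstrings). -/
theorem tempKernel_nonneg (hw0 : ∀ h, 0 ≤ w h) (V : Λ → H) (g : P → H) (V' : Λ → H) :
    0 ≤ tempKernel src tgt w V g V' :=
  Finset.prod_nonneg fun _ _ => hw0 _

/-- Auxiliary `abs_freeKernel_le_one` of the slice-kernel port (its statement is its type; rôle explained in the module ∕ section docstrings). -/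
theorem abs_freeKernel_le_one (hw0 : ∀ h, 0 ≤ w h) (hw1 : ∀ h, w h ≤ 1) (V V' : Λ → H) :
    |freeKernel w V V'| ≤ 1 := by
  unfold freeKernel
  rw [Finset.abs_prod]
  exact Finset.prod_le_one (fun l _ => abs_nonneg _) fun l _ => (abs_of_nonneg (hw0 _)).trans_le (hw1 _)

/-- Finite products of positive definite kernels are positive definite (Schur). (`private`: the same statement is `Literature.Analysis.Matrix.isPosDefKernel_finsetProd`, gate dedup.landed; kept local to avoid an unbuilt import.) -/
private theorem isPosDefKernel_finsetProd {Y ι : Type*} (s : Finset ι) {φ : ι → Y → Y → ℝ}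
    (h : ∀ i ∈ s, IsPosDefKernel (φ i)) : IsPosDefKernel fun x y => ∏ i ∈ s, φ i x y := by
  classical
  induction s using Finset.induction_on with
  | empty => simpa using isPosDefKernel_const Y zero_le_one
  | insert a s ha ih =>
    have h' := (h a (Finset.mem_insert_self a s)).mul (ih fun i hi => h i (Finset.mem_insert_of_mem hi))
    simpa [Finset.prod_insert ha] using h'

/-- The un-averaged kernel of a positive definite weight is a positive definite kernel on slice configurations
(Schur product over the links of the pulled-back one-link kernels). -/
theorem isPosDefKernel_freeKernel (hpd : IsPosDefKernel fun x y : H => w (x⁻¹ * y)) :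
    IsPosDefKernel fun V V' : Λ → H => freeKernel w V V' := by
  have h := isPosDefKernel_finsetProd (Finset.univ : Finset Λ)
    (φ := fun l (V V' : Λ → H) => w ((V l)⁻¹ * V' l)) fun l _ => hpd.comp fun V : Λ → H => V l
  simpa [freeKernel] using h

end Algebra

/-! ### §3 Measure theory of the slice kernel: Haar product measures, measure preservation, the gauge-averaged
kernel, its symmetry, measurability and POSITIVE TYPE (Lüscher's gauge averaging, general weight) -/

section MeasureTheory

open Literature.MathematicalPhysics.QuantumFieldTheory.WilsonGauge (measurePreserving_mul_mul)

variable {P Λ H : Type*} [Fintype P] [Fintype Λ] [Group H] [TopologicalSpace H] [IsTopologicalGroup H]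
  [CompactSpace H] [MeasurableSpace H] [BorelSpace H] (src tgt : Λ → P) (w : H → ℝ)

omit [Fintype P] in
/-- Central (indeed any) left twists preserve the product Haar measure of a slice. -/
theorem measurePreserving_ctwist (c : Λ → H) :
    MeasurePreserving (ctwist c) (Measure.pi fun _ : Λ => haarProbability H)
      (Measure.pi fun _ : Λ => haarProbability H) :=
  measurePreserving_pi (f := fun (l : Λ) (x : H) => c l * x) (fun _ : Λ => haarProbability H)
    (fun _ : Λ => haarProbability H) fun l => measurePreserving_mul_left (haarProbability H) (c l)

omit [Fintype P] in
/-- Gauge transformations preserve the product Haar measure of a slice (compact groups are unimodular). -/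
theorem measurePreserving_gauge (a : P → H) :
    MeasurePreserving (gauge src tgt a) (Measure.pi fun _ : Λ => haarProbability H)
      (Measure.pi fun _ : Λ => haarProbability H) :=
  measurePreserving_pi (f := fun (l : Λ) (x : H) => a (src l) * x * (a (tgt l))⁻¹) (fun _ : Λ => haarProbability H)
    (fun _ : Λ => haarProbability H) fun l => measurePreserving_mul_mul (a (src l)) (a (tgt l))⁻¹

/-- Inversion of the temporal links preserves their product Haar measure. -/
theorem measurePreserving_inv_pi :
    MeasurePreserving (fun g : P → H => g⁻¹) (Measure.pi fun _ : P => haarProbability H)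
      (Measure.pi fun _ : P => haarProbability H) :=
  measurePreserving_pi (f := fun (_ : P) (x : H) => x⁻¹) (fun _ : P => haarProbability H)
    (fun _ : P => haarProbability H) fun _ => Measure.measurePreserving_inv (haarProbability H)

/-- **The gauge-averaged slice kernel** of the weight `w`: the temporal links between the two slices are integrated
against Haar measure (Gauss-law projection), `k(V, V') = ∫ ∏_l w(V_l⁻¹ g_{src l} V'_l g_{tgt l}⁻¹) ∏_p dg_p`. -/
def avgKernel (V V' : Λ → H) : ℝ :=
  ∫ g, tempKernel src tgt w V g V' ∂(Measure.pi fun _ : P => haarProbability H)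

/-- Auxiliary `avgKernel_ctwist` of the slice-kernel port (its statement is its type; rôle explained in the module ∕ section docstrings). -/
theorem avgKernel_ctwist {c : Λ → H} (hc : ∀ l, c l ∈ Subgroup.center H) (V V' : Λ → H) :
    avgKernel src tgt w (ctwist c V) (ctwist c V') = avgKernel src tgt w V V' := by
  unfold avgKernel
  simp_rw [tempKernel_ctwist src tgt w hc]

/-- Auxiliary `abs_avgKernel_le_one` of the slice-kernel port (its statement is its type; rôle explained in the module ∕ section docstrings). -/
theorem abs_avgKernel_le_one (hw0 : ∀ h, 0 ≤ w h) (hw1 : ∀ h, w h ≤ 1) (V V' : Λ → H) :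
    |avgKernel src tgt w V V'| ≤ 1 :=
  abs_integral_le_one fun g => abs_tempKernel_le_one src tgt w hw0 hw1 V g V'

/-- Auxiliary `avgKernel_nonneg` of the slice-kernel port (its statement is its type; rôle explained in the module ∕ section docstrings). -/
theorem avgKernel_nonneg (hw0 : ∀ h, 0 ≤ w h) (V V' : Λ → H) : 0 ≤ avgKernel src tgt w V V' :=
  integral_nonneg fun g => tempKernel_nonneg src tgt w hw0 V g V'

omit [Fintype P] [CompactSpace H] [MeasurableSpace H] [BorelSpace H] in
/-- Auxiliary `continuous_tempKernel` of the slice-kernel port (its statement is its type; rôle explained in the module ∕ section docstrings). -/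
theorem continuous_tempKernel (hw : Continuous w) :
    Continuous fun q : (Λ → H) × (P → H) × (Λ → H) => tempKernel src tgt w q.1 q.2.1 q.2.2 := by
  unfold tempKernel
  refine continuous_finsetProd _ fun l _ => hw.comp ?_
  have h1 : Continuous fun q : (Λ → H) × (P → H) × (Λ → H) => q.1 l := (continuous_apply l).comp continuous_fst
  have h2 : Continuous fun q : (Λ → H) × (P → H) × (Λ → H) => q.2.1 (src l) :=
    (continuous_apply _).comp (continuous_fst.comp continuous_snd)
  have h3 : Continuous fun q : (Λ → H) × (P → H) × (Λ → H) => q.2.2 l :=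
    (continuous_apply l).comp (continuous_snd.comp continuous_snd)
  have h4 : Continuous fun q : (Λ → H) × (P → H) × (Λ → H) => q.2.1 (tgt l) :=
    (continuous_apply _).comp (continuous_fst.comp continuous_snd)
  exact ((h1.inv.mul h2).mul h3).mul h4.inv

omit [Fintype P] [CompactSpace H] [MeasurableSpace H] [BorelSpace H] in
/-- Auxiliary `continuous_freeKernel` of the slice-kernel port (its statement is its type; rôle explained in the module ∕ section docstrings). -/
theorem continuous_freeKernel (hw : Continuous w) :
    Continuous fun z : (Λ → H) × (Λ → H) => freeKernel w z.1 z.2 := by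
  unfold freeKernel
  refine continuous_finsetProd _ fun l _ => hw.comp ?_
  exact (((continuous_apply l).comp continuous_fst).inv).mul ((continuous_apply l).comp continuous_snd)

omit [Fintype P] [Fintype Λ] [CompactSpace H] [MeasurableSpace H] [BorelSpace H] in
/-- Auxiliary `continuous_gauge` of the slice-kernel port (its statement is its type; rôle explained in the module ∕ section docstrings). -/
theorem continuous_gauge : Continuous fun q : (P → H) × (Λ → H) => gauge src tgt q.1 q.2 := by
  unfold gauge
  refine continuous_pi fun l => ?_
  exact ((((continuous_apply (src l)).comp continuous_fst).mul ((continuous_apply l).comp continuous_snd)).mul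
    (((continuous_apply (tgt l)).comp continuous_fst).inv))

variable [SecondCountableTopology H]

/-- The gauge-averaged kernel is SYMMETRIC for an inversion-invariant class function (substitute `g ↦ g⁻¹`). -/
theorem avgKernel_symm (hw : Continuous w) (hinv : ∀ h, w h⁻¹ = w h) (hcl : ∀ g h, w (g * h * g⁻¹) = w h)
    (V V' : Λ → H) : avgKernel src tgt w V' V = avgKernel src tgt w V V' := by
  unfold avgKernel
  have hsm : StronglyMeasurable fun g : P → H => tempKernel src tgt w V' g V :=
    ((continuous_tempKernel src tgt w hw).comp
      (continuous_const.prodMk (continuous_id.prodMk continuous_const))).stronglyMeasurable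
  calc ∫ g, tempKernel src tgt w V' g V ∂(Measure.pi fun _ : P => haarProbability H)
      = ∫ g, tempKernel src tgt w V' g V ∂(Measure.map (fun g : P → H => g⁻¹)
          (Measure.pi fun _ : P => haarProbability H)) := by rw [(measurePreserving_inv_pi (P := P) (H := H)).map_eq]
    _ = ∫ g, tempKernel src tgt w V' g⁻¹ V ∂(Measure.pi fun _ : P => haarProbability H) :=
        integral_map_of_stronglyMeasurable (measurePreserving_inv_pi (P := P) (H := H)).measurable hsm
    _ = ∫ g, tempKernel src tgt w V g V' ∂(Measure.pi fun _ : P => haarProbability H) := by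
        simp_rw [tempKernel_swap_inv src tgt w hinv hcl]

/-- The gauge-averaged kernel is jointly (strongly) measurable. -/
theorem stronglyMeasurable_uncurry_avgKernel (hw : Continuous w) :
    StronglyMeasurable (uncurry (avgKernel src tgt w)) := by
  have h : StronglyMeasurable fun z : ((Λ → H) × (Λ → H)) × (P → H) => tempKernel src tgt w z.1.1 z.2 z.1.2 :=
    ((continuous_tempKernel src tgt w hw).comp ((continuous_fst.comp continuous_fst).prodMk
      (continuous_snd.prodMk (continuous_snd.comp continuous_fst)))).stronglyMeasurable
  exact h.integral_prod_right' (ν := Measure.pi fun _ : P => haarProbability H)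

omit [Fintype P] [Fintype Λ] [TopologicalSpace H] [IsTopologicalGroup H] [CompactSpace H] [MeasurableSpace H]
  [BorelSpace H] [SecondCountableTopology H] in
/-- A real positive-type condition in the complex finite-sum form of `TwistSplitWeight` (clause 5) gives the real
`IsPosDefKernel (x, y) ↦ w(x⁻¹y)` (test real vectors; symmetry from inversion invariance). -/
theorem isPosDefKernel_of_re_sum (hinv : ∀ h, w h⁻¹ = w h)
    (h5 : ∀ (n : ℕ) (x : Fin n → H) (v : Fin n → ℂ),
      0 ≤ (∑ i, ∑ j, (starRingEnd ℂ) (v i) * v j * ((w ((x i)⁻¹ * x j) : ℝ) : ℂ)).re) :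
    IsPosDefKernel fun x y : H => w (x⁻¹ * y) := by
  refine ⟨fun x y => ?_, fun n x c => ?_⟩
  · show w (x⁻¹ * y) = w (y⁻¹ * x)
    rw [← hinv, mul_inv_rev, inv_inv]
  have h := h5 n x fun i => (c i : ℂ)
  simpa [Complex.conj_ofReal, ← Complex.ofReal_mul, ← Complex.ofReal_sum, Complex.re_sum] using h

/-- **Lüscher positivity for a general weight.** For a continuous weight `0 ≤ w ≤ 1` that is an inversion-invariant
class function of positive type, the gauge-averaged slice kernel is of positive type against bounded measurable
real test functions: `0 ≤ ∫∫ φ(V) k(V,V') φ(V')` — the tree's `integral_integral_fibreAverage_nonneg` (fibre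
doubling + gauge averaging) with gauge transformations as fibre action, `(a, b) ↦ a/b` as doubling map, the
temporal-plaquette product as un-averaged kernel and the Schur-product kernel `∏_l w(V_l⁻¹V'_l)` as `k₀`, whose
integrated positivity against MEASURABLE `φ` is §1. [cite: Luscher1977] -/
theorem posType_avgKernel (hw : Continuous w) (hw0 : ∀ h, 0 ≤ w h) (hw1 : ∀ h, w h ≤ 1)
    (hcl : ∀ g h, w (g * h * g⁻¹) = w h) (hpd : IsPosDefKernel fun x y : H => w (x⁻¹ * y))
    (φ : (Λ → H) → ℝ) (hφ : Measurable φ) (hφ1 : ∀ V, |φ V| ≤ 1) :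
    0 ≤ ∫ V, ∫ V', φ V * avgKernel src tgt w V V' * φ V'
      ∂(Measure.pi fun _ : Λ => haarProbability H) ∂(Measure.pi fun _ : Λ => haarProbability H) := by
  have hD : MeasurePreserving (fun p : (P → H) × (P → H) => p.1 / p.2)
      ((Measure.pi fun _ : P => haarProbability H).prod (Measure.pi fun _ : P => haarProbability H))
      (Measure.pi fun _ : P => haarProbability H) :=
    (measurePreserving_fst (μ := Measure.pi fun _ : P => haarProbability H)
      (ν := Measure.pi fun _ : P => haarProbability H)).comp
      (measurePreserving_div_prod (Measure.pi fun _ : P => haarProbability H)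
        (Measure.pi fun _ : P => haarProbability H))
  have hk : Measurable fun q : (Λ → H) × (P → H) × (Λ → H) => tempKernel src tgt w q.1 q.2.1 q.2.2 :=
    (continuous_tempKernel src tgt w hw).measurable
  have hk₀ : Measurable fun z : (Λ → H) × (Λ → H) => freeKernel w z.1 z.2 := (continuous_freeKernel w hw).measurable
  have hkT : ∀ (p : (P → H) × (P → H)) (z : (Λ → H) × (Λ → H)),
      tempKernel src tgt w (gauge src tgt p.1 z.1) (p.1 / p.2) (gauge src tgt p.2 z.2) = freeKernel w z.1 z.2 :=
    fun p z => tempKernel_gauge_div src tgt w hcl p.1 p.2 z.1 z.2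
  have hTm : Measurable fun q : (P → H) × (Λ → H) => gauge src tgt q.1 q.2 := (continuous_gauge src tgt).measurable
  have hpos : ∀ ψ : (Λ → H) → ℝ, Measurable ψ → (∀ x, |ψ x| ≤ 1) →
      0 ≤ ∫ z, ψ z.1 * freeKernel w z.1 z.2 * ψ z.2
        ∂((Measure.pi fun _ : Λ => haarProbability H).prod (Measure.pi fun _ : Λ => haarProbability H)) :=
    fun ψ hψ hψ1 => IsPosDefKernel.integral_prod_nonneg_of_measurable (isPosDefKernel_freeKernel w hpd) hk₀
      (fun V V' => abs_freeKernel_le_one w hw0 hw1 V V') _ hψ hψ1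
  unfold avgKernel
  exact integral_integral_fibreAverage_nonneg (Measure.pi fun _ : Λ => haarProbability H)
    (Measure.pi fun _ : P => haarProbability H) (gauge src tgt) hTm (measurePreserving_gauge src tgt)
    (fun p => p.1 / p.2) hD φ hφ hφ1 (tempKernel src tgt w) hk (abs_tempKernel_le_one src tgt w hw0 hw1)
    (fun z => freeKernel w z.1 z.2) hk₀ (fun z => abs_freeKernel_le_one w hw0 hw1 z.1 z.2) hkT hpos

end MeasureTheory

end Summit.QuantumFields.YangMills.Cruxes.IRcof.EquipartitionSeam.SliceKernel

end
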